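import Summits.BirchSwinnertonDyer.BirchSwinnertonDyer.Theorems.ShaPrimaryTransferFiniteShaComponentTransferKernelRankThree
import Summits.BirchSwinnertonDyer.BirchSwinnertonDyer.Theorems.ShaPrimaryTransferFiniteShaComponentTransferKernelRankFour
import Summits.BirchSwinnertonDyer.BirchSwinnertonDyer.Theorems.ShaPrimaryTransferFiniteShaComponentTransferKernelRankFive
import Summits.BirchSwinnertonDyer.BirchSwinnertonDyer.Theorems.ShaPrimaryTransferFiniteShaComponentTransferKernelRankSix
import Summits.BirchSwinnertonDyer.BirchSwinnertonDyer.Theorems.ShaPrimaryTransferFiniteShaComponentTransferKernelRankSeven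

/-!
# BirchSwinnertonDyer / ShaPrimaryTransfer — crux `FiniteShaComponentTransfer` (stmt-BirchSwinnertonDyer-22356):
# the kernel ladder of the door at 2 — for every `r ≤ 7` an elliptic `E/ℚ` with `rank E(ℚ) = r`, `Ш(E)[2^∞]` of corank `0`
# and `corank Sel_{2^∞}(E) = r`, unconditionally

Route `ShaPrimaryTransfer` (D-0145 LINE 2) splits KatoTransfer's X1 into T = `FiniteShaComponentTransfer` (stmt-22356:
«`t_p(E) = 0 ⟹ t_q(E) = 0`») and the door O (stmt-22357), the door being «decided curve by curve by complete `2`-descent».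
This short synthesis file (prover seat `bsd-line-spt-p1` g5, `--supports stmt-22356 --as helper`) assembles the companions
`…OneFiniteShaComponentKernelDoors` (ranks `0, 1, 2`), `…KernelRankThree` (`3`: `y² = x³ − 82x`, and the non-CM
`y² = x³ + x² − 340x`), `…KernelRankFour` (`y² = x³ − 6497x`), `…KernelRankFive` (`y² = x³ − 361202x`), `…KernelRankSix`
(`y² = x³ − 37443457x`), `…KernelRankSeven` (`y² = x³ − 253160002x`) into one statement:

* **`exists_door_at_two_of_le_seven`** — for every `r ≤ 7` there is an elliptic `E/ℚ` with `rank E(ℚ) = r` and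
  `t_2(E) = corank_{ℤ_2} Ш(E/ℚ)[2^∞] = 0`;
* **`exists_transfer_hypothesis_of_le_seven`** — the same with `corank_{ℤ_2} Sel_{2^∞}(E/ℚ) = r` (Greenberg's identity, tree
  theorem `selmerCorank_eq_mordellWeilRank_add_holds`): T's HYPOTHESIS at the door prime `2` is kernel-certified at every
  rank `≤ 7`, in `Ш`- and in Selmer coordinates;
* `exists_oneFiniteShaComponent_instance_of_le_seven` — O is certified curve by curve at every rank `≤ 7`;
* `transfer_conclusion_of_le_seven` (T BY NAME) — granting T, at every rank `≤ 7` some `E/ℚ` of that rank has `t_q(E) = 0` and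
  `corank Sel_{q^∞}(E) = rank` at EVERY prime `q`; unconditionally this is certified for no curve of rank `≥ 2`.

All UNCONDITIONAL (standard axioms; no named fact; descent via `2`-isogeny only). So the route's instrument reaches, in the
kernel, every rank at which an elliptic curve over `ℚ` has had its rank determined in this tree, and T is non-vacuous there;
what no theorem (in print or here) supplies at rank `≥ 2` is T's conclusion. Nothing here proves T, O or BSD; T is
conjecture-grade at rank ≥ 2. References: J. H. Silverman, *AEC* 2nd ed., X.4.7, X.4.9, X.6; J. H. Silverman, J. Tate,
*Rational Points on Elliptic Curves*, §3.5–3.6; D. Zywina, arXiv:2502.01957; R. Greenberg, LNM 1716 (1999), §1.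
-/

-- D-0017: single-problem summit, so `Summit.BirchSwinnertonDyer.BirchSwinnertonDyer.…` repeats a namespace BY DESIGN.
set_option linter.dupNamespace false

noncomputable section

namespace Summit.BirchSwinnertonDyer.BirchSwinnertonDyer.Theorems.ShaPrimaryTransferKernelLadder

open scoped Classical
open WeierstrassCurve
open Summit.BirchSwinnertonDyer.BirchSwinnertonDyer.Theses.ShaPrimaryTransfer (FiniteShaComponentTransfer)
open Summit.BirchSwinnertonDyer.BirchSwinnertonDyer.Theorems

/-- **For every `r ≤ 7` there is an elliptic `E/ℚ` with `rank E(ℚ) = r` and `t_2(E) = 0`** — UNCONDITIONAL (`r ≤ 3`: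
`…KernelRankThree.exists_door_at_two_of_le_three`; `r = 4, 5, 6, 7`: `y² = x³ − nx` with `n = 6497, 361202, 37443457,
253160002`). [cite: SilvermanAEC2009, Prop. X.6.1(b) with Prop. X.4.7] -/
theorem exists_door_at_two_of_le_seven (r : ℕ) (hr : r ≤ 7) :
    ∃ W : WeierstrassCurve ℚ, W.IsElliptic ∧ W.mordellWeilRank = r ∧ W.shaCorank 2 = 0 := by
  rcases Nat.lt_or_ge r 4 with h | h
  · exact ShaPrimaryTransferKernelRankThree.exists_door_at_two_of_le_three r (by omega)
  · interval_cases r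
    · exact ⟨_, ShaPrimaryTransferKernelRankFour.isElliptic_E, ShaPrimaryTransferKernelRankFour.door_at_two_rank_four⟩
    · exact ⟨_, ShaPrimaryTransferKernelRankFive.isElliptic_E, ShaPrimaryTransferKernelRankFive.door_at_two_rank_five⟩
    · exact ⟨_, ShaPrimaryTransferKernelRankSix.isElliptic_E, ShaPrimaryTransferKernelRankSix.door_at_two_rank_six⟩
    · exact ⟨_, ShaPrimaryTransferKernelRankSeven.isElliptic_E, ShaPrimaryTransferKernelRankSeven.door_at_two_rank_seven⟩

/-- **T's hypothesis is kernel-certified at every rank ≤ 7, in both coordinates**: for every `r ≤ 7` an elliptic `E/ℚ` with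
`rank E(ℚ) = r`, `corank_{ℤ_2} Sel_{2^∞}(E/ℚ) = r` and `t_2(E) = 0`. UNCONDITIONAL. [cite: Greenberg1999LNM, §1 pp. 54–57] -/
theorem exists_transfer_hypothesis_of_le_seven (r : ℕ) (hr : r ≤ 7) :
    ∃ W : WeierstrassCurve ℚ, W.IsElliptic ∧ W.mordellWeilRank = r ∧ W.selmerCorank 2 = r ∧ W.shaCorank 2 = 0 := by
  obtain ⟨W, hW, hrk, h2⟩ := exists_door_at_two_of_le_seven r hr
  haveI := hW
  haveI : Fact (Nat.Prime 2) := ⟨Nat.prime_two⟩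
  refine ⟨W, hW, hrk, ?_, h2⟩
  rw [W.selmerCorank_eq_mordellWeilRank_add_holds 2, hrk, h2, add_zero]

/-- **O is certified curve by curve at every rank ≤ 7**: for every `r ≤ 7` some elliptic `E/ℚ` of rank `r` satisfies O (witness
prime `2`). UNCONDITIONAL. [cite: SilvermanAEC2009, Prop. X.6.1(b) with Prop. X.4.7] -/
theorem exists_oneFiniteShaComponent_instance_of_le_seven (r : ℕ) (hr : r ≤ 7) :
    ∃ W : WeierstrassCurve ℚ, W.IsElliptic ∧ W.mordellWeilRank = r ∧ ∃ (q : ℕ) (_ : Fact q.Prime), W.shaCorank q = 0 := by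
  obtain ⟨W, hW, hrk, h2⟩ := exists_door_at_two_of_le_seven r hr
  exact ⟨W, hW, hrk, 2, ⟨Nat.prime_two⟩, h2⟩

/-- **Under T, the door's consequence at every rank ≤ 7** (the crux BY NAME): granting T, for every `r ≤ 7` some elliptic `E/ℚ`
of rank `r` has `t_q(E) = 0` and `corank_{ℤ_q} Sel_{q^∞}(E/ℚ) = r` at EVERY prime `q` (so `Ш(E)` has trivial divisible part);
unconditionally this is certified in the tree for no curve of rank ≥ 2. [cite: Greenberg1999LNM, §1 pp. 54–57] -/
theorem transfer_conclusion_of_le_seven (hT : FiniteShaComponentTransfer) (r : ℕ) (hr : r ≤ 7) :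
    ∃ W : WeierstrassCurve ℚ, W.IsElliptic ∧ W.mordellWeilRank = r ∧
      ∀ (q : ℕ) [Fact q.Prime], W.shaCorank q = 0 ∧ W.selmerCorank q = r := by
  obtain ⟨W, hW, hrk, h2⟩ := exists_door_at_two_of_le_seven r hr
  haveI := hW
  haveI : Fact (Nat.Prime 2) := ⟨Nat.prime_two⟩
  refine ⟨W, hW, hrk, fun q _ => ?_⟩
  have h0 : W.shaCorank q = 0 := hT W 2 q h2
  refine ⟨h0, ?_⟩
  rw [W.selmerCorank_eq_mordellWeilRank_add_holds q, hrk, h0, add_zero]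

end Summit.BirchSwinnertonDyer.BirchSwinnertonDyer.Theorems.ShaPrimaryTransferKernelLadder

end
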